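import Summits.ResolutionOfSingularities.ResolutionOfSingularities.Theorems.PurelyInseparableDim4ChartAtlasSNCCriterion
import HarnessLib

/-!
# Purely inseparable four-folds `z^p + F(x₁, …, x₄)`: the boundary-at-infinity `Σ = closure ∖ image` of an escaping chart
# centre IS simple normal crossings with the bad pair — a repair candidate for the S3-N2 obstruction, chart level (cell
# `res-dim4-pi`, typ-2 g5)

[OURS · counted 0 · about OUR S3 (c) strategy; nothing about resolution of singularities] (D-0157 DOOR 2; DR-157-C; desk
WORD #131 (c)). `…ChartAtlasSNCObstruction` (p690374/p690709): on the chart `x_l` the escaping global centre `Zc = V(z, x_T)` is NOT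
snc with a boundary containing the «bad pair» `x_j·𝒪`, `(x_m + b x_j)·𝒪` (`m ∈ T`, `j ∉ T`, `b ≠ 0`). Both members meet `Zc` along
the same hyperplane section `Σ = Zc ∩ {x_j = 0} = V(z, x_T, x_j)` — on `W` exactly `closure ∖ image`, the points the `x_j`-chart does
not see. PROVED here (no `sorry`, no new axiom): `Σ` itself IS simple normal crossings with the bad pair:

* `exists_algEquiv_shearPair` — the automorphism `Ξ'` of `K[z, x]` with `Ξ' x_m = x_m + b x_j`, everything else fixed (`m ≠ j`);
* `comap_shearPair_𝓘Λ_of_mem` — `Spec Ξ'` fixes every coordinate centre `𝓘Λ_Λ` with `x_j ∈ Λ` (`Ξ' x_m ≡ x_m (mod x_j)`);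
  `comap_shearPair_hyperplane_self` — and carries `x_m·𝒪` to `(x_m + b x_j)·𝒪`;
* **`hasSNCWith_pair_translatedHyperplanes_𝓘Λ_insert`** — on `𝔸⁵_K`: `m ∈ T`, `m ≠ j`, any `b`, a list `l` of coordinates with
  `m ∉ l`, constants `c` vanishing on `{z} ∪ T ∪ {j}`:
  `HasSNCWith (x_j·𝒪 :: (x_m + b x_j)·𝒪 :: [(xᵢ + cᵢ)·𝒪 : i ∈ l]) 𝓘Λ_{insert j T}` (typ-2 g2's coordinate theorem along `Spec Ξ'`).

READING (repair candidate, chart level): when the bad pair is present, blow up `Σ` FIRST (regular, `⊆ V(Zc) ⊆ supp`, snc with the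
bad pair by this file); on the `x_j`-chart of `Bl_Σ` the strict transform of `Zc` reads `V(z, x_T)` again, `St((x_m + b x_j)·𝒪)` reads
`(x_m + b)·𝒪` and misses it, `St(x_j·𝒪)` is empty there, and `St(Zc)` meets no other chart of `Bl_Σ` — so the obstruction is gone
(by hand; kernel form = successor brick). HONEST SCOPE: chart model; whether the walk's measure tolerates the extra blow-up is the
planner's question; resolution of singularities in dimension ≥ 4 / characteristic `p` is NOT proved anywhere in this programme.
bears_on: LADDER-RESOLUTION:D157-DOOR2 (res-dim4-pi). Supports stmt-ResolutionOfSingularities-16155 (helper, S3-N2 repair candidate).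
-/

-- every declaration of this summit lives under `Summit.ResolutionOfSingularities.ResolutionOfSingularities`
-- (summit = problem), which the duplicate-namespace linter flags; house convention (cf. the Target file).
set_option linter.dupNamespace false

noncomputable section

open MvPolynomial Finset CategoryTheory AlgebraicGeometry Opposite TopologicalSpace
open AlgebraicGeometry.Scheme.IdealSheafData (ofIdealTop vanishingIdeal)

namespace Summit.ResolutionOfSingularities.ResolutionOfSingularities.Theorems.PIDim4

open Literature.AlgebraicGeometry.Resolution
open Literature.AlgebraicGeometry.Resolution.AffinePointBlowup (P A γ coord Wtop ξ)

namespace ChartDictionary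

variable {K : Type} [Field K] {T : Finset (Fin 4)} {j m : Fin 4} {b : K}

/-! ## §1 The automorphism `Ξ'`: `x_m ↦ x_m + b·x_j` -/

/-- **The automorphism `Ξ'` of `K[z, x]`**: `Ξ' x_m = x_m + b·x_j`, every other variable fixed (`m ≠ j`; inverse
`x_m ↦ x_m − b x_j`). -/
theorem exists_algEquiv_shearPair (hmj : m ≠ j) (b : K) :
    ∃ Ξ : A 4 K ≃ₐ[K] A 4 K, Ξ (X m.succ) = X m.succ + C b * X j.succ ∧ ∀ i : Fin (4 + 1), i ≠ m.succ → Ξ (X i) = X i := by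
  classical
  have hjm' : j.succ ≠ m.succ := fun e => hmj (Fin.succ_inj.mp e).symm
  let f : Fin (4 + 1) → A 4 K := fun i => if i = m.succ then X m.succ + C b * X j.succ else X i
  let g : Fin (4 + 1) → A 4 K := fun i => if i = m.succ then X m.succ - C b * X j.succ else X i
  have hfj : aeval f (X j.succ : A 4 K) = X j.succ := by rw [aeval_X]; exact if_neg hjm'
  have hgj : aeval g (X j.succ : A 4 K) = X j.succ := by rw [aeval_X]; exact if_neg hjm'
  have hfm : aeval f (X m.succ : A 4 K) = X m.succ + C b * X j.succ := by rw [aeval_X]; exact if_pos rfl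
  have hgm : aeval g (X m.succ : A 4 K) = X m.succ - C b * X j.succ := by rw [aeval_X]; exact if_pos rfl
  refine ⟨AlgEquiv.ofAlgHom (aeval f) (aeval g) ?_ ?_, ?_, fun i hi => ?_⟩
  · refine MvPolynomial.algHom_ext fun i => ?_
    rw [AlgHom.comp_apply, AlgHom.id_apply, aeval_X]
    by_cases hi : i = m.succ
    · subst hi
      rw [show g m.succ = X m.succ - C b * X j.succ from if_pos rfl, map_sub, map_mul, aeval_C, hfm, hfj, algebraMap_eq,
        add_sub_cancel_right]
    · rw [show g i = X i from if_neg hi, aeval_X]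
      exact if_neg hi
  · refine MvPolynomial.algHom_ext fun i => ?_
    rw [AlgHom.comp_apply, AlgHom.id_apply, aeval_X]
    by_cases hi : i = m.succ
    · subst hi
      rw [show f m.succ = X m.succ + C b * X j.succ from if_pos rfl, map_add, map_mul, aeval_C, hgm, hgj, algebraMap_eq,
        sub_add_cancel]
    · rw [show f i = X i from if_neg hi, aeval_X]
      exact if_neg hi
  · change aeval f (X m.succ) = _
    exact hfm
  · change aeval f (X i) = X i
    rw [aeval_X]
    exact if_neg hi

/-! ## §2 `Spec Ξ'` on the centres containing `x_j` and on the hyperplane `x_m` -/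

/-- **`Spec Ξ'` fixes `𝓘Λ_Λ` whenever `x_j ∈ Λ`** (`m ≠ j`): `Ξ'(xᵢ : i ∈ Λ) = (xᵢ : i ∈ Λ)` since `Ξ' x_m = x_m + b·x_j ≡ x_m`
modulo the generator `x_j` and all other generators are fixed. -/
theorem comap_shearPair_𝓘Λ_of_mem {Ξ : A 4 K ≃ₐ[K] A 4 K} (hΞm : Ξ (X m.succ) = X m.succ + C b * X j.succ)
    (hΞ : ∀ i : Fin (4 + 1), i ≠ m.succ → Ξ (X i) = X i) (hmj : m ≠ j) {Λ : Set (Fin (4 + 1))} (hjΛ : j.succ ∈ Λ) :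
    (AffineCoordBlowup.𝓘Λ 4 K Λ).comap (Spec.map (CommRingCat.ofHom (Ξ : A 4 K →+* A 4 K))) = AffineCoordBlowup.𝓘Λ 4 K Λ := by
  have hjm' : j.succ ≠ m.succ := fun e => hmj (Fin.succ_inj.mp e).symm
  rw [𝓘Λ_eq_ofIdealTop, comap_ofIdealTop_of_isAffine, Ideal.map_span, ← Set.image_comp]
  congr 1
  set F : Fin (4 + 1) → Γ(P 4 K, ⊤) := (Spec.map (CommRingCat.ofHom (Ξ : A 4 K →+* A 4 K))).appTop.hom ∘ coord 4 K with hF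
  have hgen : ∀ i, F i = (γ 4 K).symm (Ξ (X i)) := fun i => by
    rw [hF, Function.comp_apply, show coord 4 K i = (γ 4 K).symm (X i) from rfl, appTop_specMap_γ_symm, RingHom.coe_coe]
  have hFi : ∀ i, i ≠ m.succ → F i = coord 4 K i := fun i hi => by rw [hgen, hΞ i hi]; rfl
  have hFm : F m.succ = coord 4 K m.succ + (γ 4 K).symm (C b) * coord 4 K j.succ := by
    rw [hgen, hΞm, map_add, map_mul]; rfl
  apply le_antisymm
  · rw [Ideal.span_le]
    rintro _ ⟨i, hi, rfl⟩
    by_cases him : i = m.succ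
    · rw [him, hFm]
      exact Ideal.add_mem _ (Ideal.subset_span ⟨m.succ, him ▸ hi, rfl⟩)
        (Ideal.mul_mem_left _ _ (Ideal.subset_span ⟨j.succ, hjΛ, rfl⟩))
    · rw [hFi i him]
      exact Ideal.subset_span ⟨i, hi, rfl⟩
  · rw [Ideal.span_le]
    rintro _ ⟨i, hi, rfl⟩
    by_cases him : i = m.succ
    · have h1 : coord 4 K m.succ = F m.succ - (γ 4 K).symm (C b) * F j.succ := by
        rw [hFm, hFi j.succ hjm']; ring
      rw [him, h1]
      exact Ideal.sub_mem _ (Ideal.subset_span ⟨m.succ, him ▸ hi, rfl⟩)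
        (Ideal.mul_mem_left _ _ (Ideal.subset_span ⟨j.succ, hjΛ, rfl⟩))
    · rw [← hFi i him]
      exact Ideal.subset_span ⟨i, hi, rfl⟩

/-- `Spec Ξ'` carries `x_m·𝒪` to `(x_m + b·x_j)·𝒪`. -/
theorem comap_shearPair_hyperplane_self {Ξ : A 4 K ≃ₐ[K] A 4 K} (hΞm : Ξ (X m.succ) = X m.succ + C b * X j.succ) :
    (ofIdealTop (Ideal.span {(γ 4 K).symm (X m.succ + C 0)})).comap (Spec.map (CommRingCat.ofHom (Ξ : A 4 K →+* A 4 K))) =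
      ofIdealTop (Ideal.span {(γ 4 K).symm (X m.succ + C b * X j.succ)}) := by
  rw [comap_ofIdealTop_span_γ_symm, RingHom.coe_coe, C_0, add_zero, hΞm]

/-! ## §3 The bad pair IS snc with the smaller centre `V(z, x_T, x_j)` -/

/-- **`Σ = V(z, x_T, x_j)` HAS SIMPLE NORMAL CROSSINGS WITH THE BAD PAIR.** On `𝔸⁵_K`, for `m ∈ T`, `m ≠ j`, any `b`, a list `l` of
coordinates with `m ∉ l` and constants `c` vanishing on `{z} ∪ (T ∪ {j})`:
`HasSNCWith (x_j·𝒪 :: (x_m + b·x_j)·𝒪 :: [(xᵢ + cᵢ)·𝒪 : i ∈ l]) 𝓘Λ_{insert j T}`. -/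
theorem hasSNCWith_pair_translatedHyperplanes_𝓘Λ_insert (hmT : m ∈ T) (hmj : m ≠ j) (b : K) (l : List (Fin (4 + 1)))
    (hml : m.succ ∉ l) (c : Fin (4 + 1) → K)
    (hc : ∀ i ∈ insert (0 : Fin (4 + 1)) (Fin.succ '' ((insert j T : Finset (Fin 4)) : Set (Fin 4))), c i = 0) :
    HasSNCWith (ofIdealTop (Ideal.span {(γ 4 K).symm (X j.succ)}) ::
        ofIdealTop (Ideal.span {(γ 4 K).symm (X m.succ + C b * X j.succ)}) ::
        l.map fun i => ofIdealTop (Ideal.span {(γ 4 K).symm (X i + C (c i))}))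
      (AffineCoordBlowup.𝓘Λ 4 K (insert 0 (Fin.succ '' ((insert j T : Finset (Fin 4)) : Set (Fin 4))))) := by
  classical
  obtain ⟨Ξ, hΞm, hΞ⟩ := exists_algEquiv_shearPair (K := K) hmj b
  haveI : IsIso (CommRingCat.ofHom (Ξ : A 4 K →+* A 4 K)) :=
    (inferInstance : IsIso Ξ.toRingEquiv.toCommRingCatIso.hom)
  have hjm' : j.succ ≠ m.succ := fun e => hmj (Fin.succ_inj.mp e).symm
  set Λ' : Set (Fin (4 + 1)) := insert 0 (Fin.succ '' ((insert j T : Finset (Fin 4)) : Set (Fin 4))) with hΛ'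
  have hjΛ' : j.succ ∈ Λ' := Set.mem_insert_of_mem _ ⟨j, by rw [Finset.coe_insert]; exact Set.mem_insert _ _, rfl⟩
  have hmΛ' : m.succ ∈ Λ' :=
    Set.mem_insert_of_mem _ ⟨m, by rw [Finset.coe_insert]; exact Set.mem_insert_of_mem _ (Finset.mem_coe.mpr hmT), rfl⟩
  have hcj : c j.succ = 0 := hc _ hjΛ'
  have hcm : c m.succ = 0 := hc _ hmΛ'
  have h0 := hasSNCWith_translatedHyperplanes_𝓘Λ (K := K) (j.succ :: m.succ :: l) c Λ' hc
  have h1 := h0.comap_of_isOpenImmersion (Spec.map (CommRingCat.ofHom (Ξ : A 4 K →+* A 4 K)))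
  rw [comap_shearPair_𝓘Λ_of_mem hΞm hΞ hmj hjΛ'] at h1
  simp only [List.map_cons, List.map_map] at h1
  convert h1 using 2
  · rw [comap_unshear_hyperplane_of_fix (hΞ j.succ hjm'), hcj, C_0, add_zero]
  · congr 1
    · rw [hcm, comap_shearPair_hyperplane_self hΞm]
    · refine List.map_congr_left fun i hi => ?_
      have him : i ≠ m.succ := fun e => hml (e ▸ hi)
      rw [Function.comp_apply, comap_unshear_hyperplane_of_fix (hΞ i him)]

end ChartDictionary

end Summit.ResolutionOfSingularities.ResolutionOfSingularities.Theorems.PIDim4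

end
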